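import Literature.NumberTheory.NumberFields.ImaginaryAbelianFieldOddChiClassNumber
import Literature.NumberTheory.NumberFields.ImaginaryAbelianClassGroupOddPartBernoulli
import Literature.NumberTheory.NumberFields.InertiaGeneratesGalois
import Literature.NumberTheory.Automorphic.BCDTTheoremBWildAtThreeDet
import Mathlib.NumberTheory.NumberField.Discriminant.Different
import HarnessLib

/-!
# The two typings of Mazur–Wiles 1984 Thm. 2 agree: the `Γ_ℚ`-pointwise dictionary implies the
# Frobenius-avatar dictionary, hence `thm2_oddChiPart… → thm2_card_oddChiClassGroup…`

Topic `Literature/NumberTheory/NumberFields`, namespace `Literature.NumberTheory.NumberFields`. THEOREMS ONLY (no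
definition, no named fact). The tree holds two statement-only typings of the same printed theorem (Mazur–Wiles 1984,
Thm. 2, p. 216, in the words of Solomon 1990 p. 468):
`MazurWiles1984.thm2_card_oddChiClassGroup_eq_bernoulli` (`ImaginaryAbelianFieldOddChiClassNumber.lean`; dictionary
"`ψ(τ̄) = χ(χ_f(τ))` for all `τ ∈ Γ_ℚ`", `τ̄ = absGaloisQuot ℚ K τ`, `χ_f` the mod-`f` cyclotomic character) and
`MazurWiles1984.thm2_oddChiPart_classGroup_card_eq_pow_val_bernoulli` (`ImaginaryAbelianClassGroupOddPartBernoulli.lean`;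
dictionary `IsDirichletAvatar K ψ χ m`: "`ψ(σ) = χ(ℓ)` for every prime `ℓ ∤ m`, every prime `v ∣ ℓ` of `K` and every
arithmetic Frobenius `σ` at `v`"). This file proves that the FIRST dictionary implies the SECOND with
`m = f · |d_K|` (`isDirichletAvatar_of_forall_absGaloisQuot`), whence the second typing implies the first
(`MazurWiles1984.thm2_card_oddChiClassGroup_eq_bernoulli_of_thm2_oddChiPart`): the two named facts carry ONE debt.

The number theory used (all proved in the tree / Mathlib): an arithmetic Frobenius `τ ∈ Γ_ℚ` at a prime `𝔓` of `ℤ̄`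
above `ℓ` restricts to an arithmetic Frobenius `τ̄ ∈ Gal(K/ℚ)` at `𝔓 ∩ 𝓞_K` (`isArithFrobAt_absGaloisQuot`, Neukirch I (9.4));
every prime of `K` is `𝔓 ∩ 𝓞_K` for some `𝔓` (lying over, `exists_primesAbove_comap_eq`); at a prime `ℓ ∤ d_K` the
Frobenius in `Gal(K/ℚ)` is unique (Mathlib `IsArithFrobAt.mul_inv_mem_inertia`, `NumberField.not_dvd_discr_iff_forall_mem`,
tree `inertia_eq_bot_of_isUnramifiedAt`); and `χ_f(τ) = ℓ` (tree `Rat.modNCyclotomicCharacter_of_isArithFrobAt`). The two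
Bernoulli normalisations agree for primitive `χ` (`bernoulliOnePrim_inv_eq_generalizedBernoulli`, Mathlib `conductor_inv`).
HONEST FRAMING: BSD is not proved by any of this; nothing here discharges either named fact. Typed for the bsd-print-cfram
cell (crux `stmt-BirchSwinnertonDyer-20372`, Stub H, typing item T5) at the referee's disposal for de-duplication.

## References

* [MazurWiles1984] Thm. 2 (p. 216); [Solomon1990] §I pp. 467–468, §II.2 p. 471 (`σ_n` "the image of `n` under the
  Artin map", `χ(n) = χ(σ_n)`).
* [NeukirchANT1999] Ch. I §9 (9.4)–(9.5) (Frobenius under restriction), Ch. III (2.6)/(2.11) (unramified ⟺ `ℓ ∤ d_K`).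
-/

noncomputable section

open NumberField Field IsDedekindDomain
open Literature.NumberTheory.GaloisRepresentations Literature.NumberTheory.EllipticCurves
open Literature.NumberTheory.LFunctions

namespace Literature.NumberTheory.NumberFields

/-! ## §1 Frobenius restricts along `Γ_ℚ → Gal(K/ℚ)` -/

section Frobenius

variable (K : Type) [Field K] [NumberField K] [IsGalois ℚ K]

/-- **Restriction of Frobenius** (Neukirch I (9.4)): if `τ ∈ Γ_ℚ` is an arithmetic Frobenius at a prime `𝔓` of `ℤ̄`
above the rational prime `ℓ`, then `τ̄ = absGaloisQuot ℚ K τ ∈ Gal(K/ℚ)` is an arithmetic Frobenius at the prime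
`𝔓 ∩ 𝓞_K` of `K` (pulled back along the integral embedding `absEmbeddingInt ℚ K : 𝓞 K → ℤ̄`).
[cite: NeukirchANT1999, Ch. I §9 Prop. (9.4) and (9.5)] -/
theorem isArithFrobAt_absGaloisQuot {ℓ : ℕ} (hℓ : ℓ.Prime) {v : HeightOneSpectrum (𝓞 ℚ)}
    (hv : (ℓ : 𝓞 ℚ) ∈ v.asIdeal) {𝔓 : Ideal (absIntegers (𝓞 ℚ) ℚ)} (h𝔓 : 𝔓 ∈ v.primesAbove)
    {τ : absoluteGaloisGroup ℚ} (hτ : IsArithFrobAt (𝓞 ℚ) τ 𝔓) :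
    IsArithFrobAt ℤ (absGaloisQuot ℚ K τ) (𝔓.comap (absEmbeddingInt ℚ K)) := by
  haveI : 𝔓.IsPrime := h𝔓.1
  set Q : Ideal (𝓞 K) := 𝔓.comap (absEmbeddingInt ℚ K) with hQ
  -- `ℓ ∈ 𝔓`
  have hℓ𝔓 : ((ℓ : ℕ) : absIntegers (𝓞 ℚ) ℚ) ∈ 𝔓 := by
    have h := Ideal.mem_comap.mp (h𝔓.2.over ▸ hv : (ℓ : 𝓞 ℚ) ∈ 𝔓.under (𝓞 ℚ))
    rwa [map_natCast] at h
  -- the exponent on the `K` side is `ℓ`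
  have hunder : Q.under ℤ = Ideal.span {(ℓ : ℤ)} := by
    have hprime : (Q.under ℤ).IsPrime := Ideal.IsPrime.under ℤ Q
    have hmax : (Ideal.span {(ℓ : ℤ)}).IsMaximal :=
      PrincipalIdealRing.isMaximal_of_irreducible (Nat.prime_iff_prime_int.mp hℓ).irreducible
    refine (hmax.eq_of_le hprime.ne_top ?_).symm
    rw [Ideal.span_le, Set.singleton_subset_iff, SetLike.mem_coe, Ideal.under_def, Ideal.mem_comap,
      hQ, Ideal.mem_comap, map_natCast, map_natCast]
    exact hℓ𝔓
  have hcard : Nat.card (ℤ ⧸ Q.under ℤ) = ℓ := by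
    rw [hunder, Nat.card_congr (Int.quotientSpanNatEquivZMod ℓ).toEquiv, Nat.card_zmod]
  -- the Frobenius congruence, transported along `absEmbeddingInt`
  intro y
  change (absGaloisQuot ℚ K τ) • y - y ^ Nat.card (ℤ ⧸ Q.under ℤ) ∈ Q
  rw [hcard, hQ, Ideal.mem_comap, map_sub, map_pow]
  have hy := (HeightOneSpectrum.isArithFrobAt_iff_of_mem_primesAbove h𝔓 τ).mp hτ (absEmbeddingInt ℚ K y)
  rw [Rat.residueCard_eq_of_natCast_mem hℓ hv] at hy
  have heq : absEmbeddingInt ℚ K ((absGaloisQuot ℚ K τ) • y) = τ • absEmbeddingInt ℚ K y := by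
    apply Subtype.ext
    rw [coe_absEmbeddingInt, integralClosure.coe_smul, coe_absEmbeddingInt,
      Literature.NumberTheory.GaloisRepresentations.RingOfIntegers.coe_galois_smul,
      absEmbedding_absGaloisQuot_apply]
  rw [heq]
  exact hy

/-- **Lying over `ℤ̄ ⊇ 𝓞_K`**: every prime `v ∣ ℓ` of `K` is `𝔓 ∩ 𝓞_K` for some prime `𝔓` of `ℤ̄` above `ℓ`.
[cite: NeukirchANT1999, Ch. I §9 (primes above, (9.1))] -/
theorem exists_primesAbove_comap_eq {ℓ : ℕ} (hℓ : ℓ.Prime) (w : HeightOneSpectrum (𝓞 K))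
    (hw : (ℓ : 𝓞 K) ∈ w.asIdeal) :
    ∃ (v : HeightOneSpectrum (𝓞 ℚ)) (𝔓 : Ideal (absIntegers (𝓞 ℚ) ℚ)),
      (ℓ : 𝓞 ℚ) ∈ v.asIdeal ∧ 𝔓 ∈ v.primesAbove ∧ 𝔓.comap (absEmbeddingInt ℚ K) = w.asIdeal := by
  classical
  letI : Algebra (𝓞 K) (absIntegers (𝓞 ℚ) ℚ) := (absEmbeddingInt ℚ K).toAlgebra
  -- `ℤ̄` is integral over `𝓞 K`
  haveI : Algebra.IsIntegral (𝓞 K) (absIntegers (𝓞 ℚ) ℚ) := by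
    refine ⟨fun x => ?_⟩
    have hxQ : IsIntegral (𝓞 ℚ) x := Algebra.IsIntegral.isIntegral x
    have hxZ : IsIntegral ℤ x := isIntegral_trans (R := ℤ) (A := 𝓞 ℚ) x hxQ
    haveI : IsScalarTower ℤ (𝓞 K) (absIntegers (𝓞 ℚ) ℚ) :=
      IsScalarTower.of_algebraMap_eq' (RingHom.ext_int _ _).symm
    exact hxZ.tower_top
  haveI : w.asIdeal.IsPrime := w.isPrime
  -- the integral embedding is injective
  have hinj : Function.Injective (algebraMap (𝓞 K) (absIntegers (𝓞 ℚ) ℚ)) := by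
    intro y₁ y₂ hy
    have h := congrArg (fun z : absIntegers (𝓞 ℚ) ℚ => (z : AlgebraicClosure ℚ)) hy
    change ((absEmbeddingInt ℚ K y₁ : absIntegers (𝓞 ℚ) ℚ) : AlgebraicClosure ℚ) =
      ((absEmbeddingInt ℚ K y₂ : absIntegers (𝓞 ℚ) ℚ) : AlgebraicClosure ℚ) at h
    rw [coe_absEmbeddingInt, coe_absEmbeddingInt] at h
    exact NumberField.RingOfIntegers.coe_injective ((absEmbedding ℚ K).injective h)
  obtain ⟨𝔓, -, h𝔓prime, h𝔓comap⟩ := Ideal.exists_ideal_over_prime_of_isIntegral w.asIdeal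
    (⊥ : Ideal (absIntegers (𝓞 ℚ) ℚ)) (by rw [Ideal.comap_bot_of_injective _ hinj]; exact bot_le)
  -- `𝔓` lies above the rational prime `ℓ`
  have hℓ𝔓 : ((ℓ : ℕ) : absIntegers (𝓞 ℚ) ℚ) ∈ 𝔓 := by
    have h : algebraMap (𝓞 K) (absIntegers (𝓞 ℚ) ℚ) (ℓ : 𝓞 K) ∈ 𝔓 := by
      rw [← Ideal.mem_comap, h𝔓comap]; exact hw
    rwa [map_natCast] at h
  have hne : 𝔓.under (𝓞 ℚ) ≠ ⊥ := by
    intro h0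
    have h1 : (ℓ : 𝓞 ℚ) ∈ 𝔓.under (𝓞 ℚ) := by
      rw [Ideal.under_def, Ideal.mem_comap, map_natCast]; exact hℓ𝔓
    rw [h0, Ideal.mem_bot] at h1
    exact hℓ.ne_zero (by exact_mod_cast h1)
  haveI : 𝔓.IsPrime := h𝔓prime
  let v : HeightOneSpectrum (𝓞 ℚ) := ⟨𝔓.under (𝓞 ℚ), Ideal.IsPrime.under _ 𝔓, hne⟩
  have hvℓ : (ℓ : 𝓞 ℚ) ∈ v.asIdeal := by
    change (ℓ : 𝓞 ℚ) ∈ 𝔓.under (𝓞 ℚ)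
    rw [Ideal.under_def, Ideal.mem_comap, map_natCast]; exact hℓ𝔓
  refine ⟨v, 𝔓, hvℓ, ⟨h𝔓prime, ⟨rfl⟩⟩, ?_⟩
  exact h𝔓comap

/-- At a prime `ℓ ∤ d_K` the arithmetic Frobenius in `Gal(K/ℚ)` at a prime `w ∣ ℓ` of `K` is UNIQUE: two arithmetic
Frobenius elements at `w` differ by an element of the inertia group of `w`, which is trivial since `w` is unramified
over `ℤ`. [cite: NeukirchANT1999, Ch. I §9 (9.4)–(9.5); Ch. III Cor. (2.12) (ℓ ∤ d_K ⟹ unramified)] -/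
theorem eq_of_isArithFrobAt_of_not_dvd_discr {ℓ : ℕ} (hℓ : ℓ.Prime) (hℓd : ¬ ((ℓ : ℤ) ∣ NumberField.discr K))
    {w : HeightOneSpectrum (𝓞 K)} (hw : (ℓ : 𝓞 K) ∈ w.asIdeal) {σ σ' : K ≃ₐ[ℚ] K}
    (hσ : IsArithFrobAt ℤ σ w.asIdeal) (hσ' : IsArithFrobAt ℤ σ' w.asIdeal) : σ = σ' := by
  haveI : w.asIdeal.IsMaximal := w.isMaximal
  haveI : Algebra.IsUnramifiedAt ℤ w.asIdeal :=
    (NumberField.not_dvd_discr_iff_forall_mem K (𝓞 K) (Nat.prime_iff_prime_int.mp hℓ)).mp hℓd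
      w.asIdeal w.isPrime (by rw [Int.cast_natCast]; exact hw)
  have hmem := IsArithFrobAt.mul_inv_mem_inertia hσ hσ'
  rw [inertia_eq_bot_of_isUnramifiedAt K (K ≃ₐ[ℚ] K) w.asIdeal, Subgroup.mem_bot] at hmem
  exact mul_inv_eq_one.mp hmem

end Frobenius

/-! ## §2 The `Γ_ℚ`-pointwise dictionary implies the Frobenius-avatar dictionary -/

section Avatar

variable {p : ℕ} [Fact p.Prime] (K : Type) [Field K] [NumberField K] [IsGalois ℚ K]

/-- **`ψ(τ̄) = χ(χ_f(τ))` on `Γ_ℚ` ⟹ `IsDirichletAvatar K ψ χ (f · |d_K|)`.** For a prime `ℓ ∤ f · d_K`, a prime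
`w ∣ ℓ` of `K` and an arithmetic Frobenius `σ ∈ Gal(K/ℚ)` at `w`: `w = 𝔓 ∩ 𝓞_K` for a prime `𝔓 ∣ ℓ` of `ℤ̄`, an
arithmetic Frobenius `τ ∈ Γ_ℚ` at `𝔓` restricts to a Frobenius at `w`, which is `σ` (`ℓ ∤ d_K`), and `χ_f(τ) = ℓ`; so
`ψ(σ) = ψ(τ̄) = χ(ℓ)` — Solomon's "`σ_n` the image of `n` under the Artin map … `χ(n)` for `χ(σ_n)`".
[cite: Solomon1990, §II.2 p. 471 (σ_n, χ(n) = χ(σ_n))] [cite: NeukirchANT1999, Ch. I §9 (9.4)–(9.5)] -/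
theorem isDirichletAvatar_of_forall_absGaloisQuot {f : ℕ} [NeZero f] (χ : DirichletCharacter ℚ_[p] f)
    (ψ : (K ≃ₐ[ℚ] K) →* ℤ_[p]ˣ)
    (hψχ : ∀ τ : absoluteGaloisGroup ℚ,
      (((ψ (absGaloisQuot ℚ K τ) : ℤ_[p]ˣ) : ℤ_[p]) : ℚ_[p]) =
        χ ((modNCyclotomicCharacter ℚ f τ : (ZMod f)ˣ) : ZMod f)) :
    IsDirichletAvatar K ψ χ (f * (NumberField.discr K).natAbs) := by
  refine ⟨Nat.pos_of_ne_zero (Nat.mul_ne_zero (NeZero.ne f)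
    (Int.natAbs_ne_zero.mpr (NumberField.discr_ne_zero K))), fun ℓ hℓ hℓm w hw σ hσ => ?_⟩
  have hℓf : ¬ ℓ ∣ f := fun h => hℓm (dvd_mul_of_dvd_left h _)
  have hℓd : ¬ ((ℓ : ℤ) ∣ NumberField.discr K) := fun h =>
    hℓm (dvd_mul_of_dvd_right (Int.natCast_dvd.mp ((Int.dvd_natAbs).mpr h)) _)
  obtain ⟨v, 𝔓, hv, h𝔓, hcomap⟩ := exists_primesAbove_comap_eq K hℓ w hw
  obtain ⟨τ, hτ⟩ := HeightOneSpectrum.exists_isArithFrobAt_of_mem_primesAbove_holds (K := ℚ) (v := v) h𝔓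
  have hτ' : IsArithFrobAt ℤ (absGaloisQuot ℚ K τ) w.asIdeal := by
    rw [← hcomap]; exact isArithFrobAt_absGaloisQuot K hℓ hv h𝔓 hτ
  have hστ : σ = absGaloisQuot ℚ K τ := eq_of_isArithFrobAt_of_not_dvd_discr K hℓ hℓd hw hσ hτ'
  rw [hστ, hψχ τ, Rat.modNCyclotomicCharacter_of_isArithFrobAt hℓ hℓf hv h𝔓 hτ]

end Avatar

/-! ## §3 The bridge between the two typings -/

section Bridge

variable {p : ℕ} [Fact p.Prime]

/-- The two Bernoulli normalisations agree for a PRIMITIVE character: `B_{1,·}` of the primitive character of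
`χ⁻¹` (`KrizLi2019.bernoulliOnePrim χ⁻¹`) is `B_{1,χ⁻¹}` at level `f` (`generalizedBernoulli 1 χ⁻¹`), because `χ⁻¹` is
primitive with `χ` (Mathlib `DirichletCharacter.conductor_inv`). [cite: Solomon1990, §II.2 p. 471 (B_{1,χ⁻¹} for χ of conductor f)] -/
theorem bernoulliOnePrim_inv_eq_generalizedBernoulli {f : ℕ} [NeZero f] {χ : DirichletCharacter ℚ_[p] f}
    (hprim : χ.IsPrimitive) :
    KrizLi2019.bernoulliOnePrim χ⁻¹ = generalizedBernoulli 1 χ⁻¹ := by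
  have hc : χ⁻¹.conductor = f := by rw [DirichletCharacter.conductor_inv]; exact hprim
  rw [KrizLi2019.bernoulliOnePrim_def]
  haveI : NeZero χ⁻¹.conductor := ⟨DirichletCharacter.conductor_ne_zero _⟩
  -- compare levels `χ⁻¹.conductor = f`: once the levels are identified, `changeLevel` is the identity
  have key : ∀ {N₁ N₂ : ℕ} [NeZero N₁] [NeZero N₂] (_ : N₁ = N₂) (hd : N₁ ∣ N₂)
      (χ₁ : DirichletCharacter ℚ_[p] N₁) (χ₂ : DirichletCharacter ℚ_[p] N₂),
      DirichletCharacter.changeLevel hd χ₁ = χ₂ → generalizedBernoulli 1 χ₁ = generalizedBernoulli 1 χ₂ := by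
    intro N₁ N₂ _ _ h hd χ₁ χ₂ hch
    subst h
    rw [DirichletCharacter.changeLevel_self] at hch
    rw [hch]
  exact key hc χ⁻¹.conductor_dvd_level χ⁻¹.primitiveCharacter χ⁻¹
    (DirichletCharacter.changeLevel_primitiveCharacter χ⁻¹)

/-- **The second typing implies the first.** `MazurWiles1984.thm2_oddChiPart_classGroup_card_eq_pow_val_bernoulli`
(Frobenius-avatar dictionary) ⟹ `MazurWiles1984.thm2_card_oddChiClassGroup_eq_bernoulli` (`Γ_ℚ`-pointwise dictionary):
the hypotheses of the latter give `IsDirichletAvatar K ψ χ (f·|d_K|)` (`isDirichletAvatar_of_forall_absGaloisQuot`) and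
the weaker "`χ ≠ ω`" clause; the conclusions `#A^χ = p^n, ‖B_{1,χ⁻¹}‖ = p^{-n}` and `#A^χ = ‖B_{1,χ⁻¹}‖⁻¹` match by
`bernoulliOnePrim_inv_eq_generalizedBernoulli`. So the two named facts of the tree carry a single debt.
[cite: MazurWiles1984, Thm. 2 (p. 216) — via Solomon1990, §I p. 468] -/
theorem MazurWiles1984.thm2_card_oddChiClassGroup_eq_bernoulli_of_thm2_oddChiPart
    (h : MazurWiles1984.thm2_oddChiPart_classGroup_card_eq_pow_val_bernoulli) :
    MazurWiles1984.thm2_card_oddChiClassGroup_eq_bernoulli := by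
  intro p _ hp2 K _ _ _ hpK f _ χ hprim hodd hχω ψ hψχ
  have havatar := isDirichletAvatar_of_forall_absGaloisQuot K χ ψ hψχ
  have hω : ¬ (f = p ∧ ∀ a : ℤ, ¬ ((p : ℤ) ∣ a) → ‖χ (a : ZMod f) - (a : ℚ_[p])‖ < 1) :=
    fun hand => hχω hand.2
  obtain ⟨n, hcard, hnorm⟩ := h p hp2 K hpK ψ f χ _ hprim havatar hodd hω
  rw [hcard, bernoulliOnePrim_inv_eq_generalizedBernoulli hprim, hnorm, zpow_neg, inv_inv, zpow_natCast,
    Nat.cast_pow]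

end Bridge

end Literature.NumberTheory.NumberFields

end
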